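import Summits.MatrixMultiplication.MatrixMultiplication.Theorems.AbelianSTPPCensusTAKnap575Defs
import Summits.MatrixMultiplication.MatrixMultiplication.Theorems.AbelianSTPPCensusTASharp474

/-!
# The T_A ceiling of the instrument vM ∪ E3: the uniform list `(7,7,7)⁷` passes every rule from order `686 = 2·7³` on

Cell mm-stpp (rung F-M1), threshold T_A (`τ = 2.371`, the record exponent).  The knapsack certificate with the three-room energy clause
(`AbelianSTPPCensusTAKnap575*.lean`, seat theory g10) certifies «no shape list that is vM-admissible (`SieveAdmissible`) and E3-admissible
(`TAKnap575.E3Adm`) beats `2.371`» at every abelian order `474 … 575`; that RELAXATION first fails at `576`.  This file bounds what ANY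
certificate over the same rule set can reach: at every order `686 ≤ M ≤ 706` the seven-member uniform list `(7,7,7)⁷` (all volumes
`343 = 7³`) satisfies every clause of vM (`SieveAdmissible M`: U1, Neumann `7·13 = 91`, U2 `7·49 = 343`, U11 per member `14·49 = 686 ≤ M + 7`,
U13/U9′, U14 `343 + 6·49 = 637 < M` so every tightness clause is vacuous), satisfies E3 VACUOUSLY — the hypothesis `2V = 686 > M` of
`STPPThreeRoomEnergy.three_room_energy` (and of `three_room_energy_plus`, E3⁺) fails for every member — and beats `2.371`:
`7 · 343^{2371/3000} > 7 · 100.861971 = 706.03… > M` (minimality half of the landed gain table at `V = 343`, `ShapeCert.gain2371_minimal`,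
via `TAKnap.gain2371_sub_one_lt_rpow`).  Hence «vM ∧ E3 ⇒ not beating» is FALSE at `686` (`vmE3CensusTA_false_at_686`): the T_A column of the
instrument vM ∪ E3 (∪ E3⁺) ends at or before `685`, exactly at the silence boundary `M = 2V` of the energy rules for the cube `7³` — as
`TAKnap.vmCensusTA_false_at_474` located the vM-only column at `473 | 474`.  Below `686` the members `(7,7,7)` ARE subject to E3 and the list
`(7,7,7)⁷` dies (`679 ≤ M ≤ 685`: `M·(343 − 3(M − 637)) ≥ 679·199 > 343²`), as does `(7,7,7)⁶` on its whole beating window `588 … 605`.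
Whether some mixed list passes vM ∪ E3⁺ at an order in `576 … 685` is not claimed either way (seat eng-2's kit probe j267317 enumerates it).
WHAT THIS IS NOT: no STPP family of shapes `(7,7,7)⁷` is claimed to exist in any abelian group of order `686 … 706` (the instrument only
fails to exclude it — R-5 (Q-ii) of the cell's KILL-MEMO, the near-tight uniform regime); no bound on `ω`; nothing about `T_E`/`T_D`.
-/

-- single-conjunct summit: the mandated namespace repeats `MatrixMultiplication`.
set_option linter.dupNamespace false
set_option autoImplicit false

namespace Summit.MatrixMultiplication.MatrixMultiplication.Theorems

namespace TAKnap575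

open Finset ShapeCert

/-- The landed table value at the cube `7³`: `gainOf2371 343 = 100 861 972 = ⌈10⁶ · 343^{2371/3000}⌉`. [bookkeeping] -/
theorem gainOf2371_343 : gainOf2371 343 = 100861972 := by decide +kernel

/-- `100.861971 < 343^{(2371/1000)/3}`. [bookkeeping] -/
theorem rpow_343_gt : (100861971 : ℝ) / 1000000 < ((343 : ℕ) : ℝ) ^ ((2371 / 1000 : ℝ) / 3) := by
  have h := TAKnap.gain2371_sub_one_lt_rpow 343 (by norm_num) (by norm_num)
  rw [gainOf2371_343] at h
  exact_mod_cast h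

/-- **`(7,7,7)⁷` is vM-admissible at every order `M ≥ 686`** (in fact U11 per member only needs `M ≥ 679` and U14 `M ≥ 637`; stated from
`686`, where it matters). [original] -/
theorem sieveAdmissible_777x7 (M : ℕ) (hM : 686 ≤ M) :
    SieveAdmissible M (fun _ : Fin 7 => 7) (fun _ : Fin 7 => 7) (fun _ : Fin 7 => 7) := by
  have hsum6 : ∀ l : Fin 7, ∑ t ∈ univ.erase l, (7 * 7 : ℕ) = 294 := by
    intro l
    rw [sum_const, card_erase_of_mem (mem_univ l), card_univ, Fintype.card_fin, smul_eq_mul]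
  have hsum7 : ∑ _i : Fin 7, (7 * 7 : ℕ) = 343 := by
    rw [sum_const, card_univ, Fintype.card_fin, smul_eq_mul]
  have hsum7' : ∑ _i : Fin 7, (7 * (7 + 7) : ℕ) = 686 := by
    rw [sum_const, card_univ, Fintype.card_fin, smul_eq_mul]
  refine ⟨fun i => ?_, fun i => ?_, ?_, fun i => ?_, fun i j _ => ?_, fun l => ?_, fun l => ?_⟩
  · simp only [shapeVol]; omega
  · dsimp only; omega
  · rw [hsum7]; omega
  · rw [hsum7']; omega
  · simp only [shapeVol]; omega
  · simp only [u14Sum, shapeVol, hsum6]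
    exact ⟨by omega, fun h => absurd h (by omega), by omega, fun h => absurd h (by omega), by omega,
      fun h => absurd h (by omega)⟩
  · simp only [u14Sum, shapeVol, hsum6]
    exact ⟨fun h _ => absurd h (by omega), fun h _ => absurd h (by omega), fun h _ => absurd h (by omega)⟩

/-- **`(7,7,7)⁷` satisfies the shape form of E3 at every order `M ≥ 686` — vacuously**: no member has `2V = 686 > M`. [original] -/
theorem e3Adm_777x7 (M : ℕ) (hM : 686 ≤ M) :
    TAKnap575.E3Adm M (fun _ : Fin 7 => 7) (fun _ : Fin 7 => 7) (fun _ : Fin 7 => 7) := by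
  intro t ht
  exfalso
  dsimp only at ht
  omega

/-- **`(7,7,7)⁷` beats `τ = 2.371` at every order `M ≤ 706`**: `7 · 343^{2371/3000} > 706.03`. [original] -/
theorem beats_777x7 (M : ℕ) (hM : M ≤ 706) :
    Beats (2371 / 1000) M (fun _ : Fin 7 => 7) (fun _ : Fin 7 => 7) (fun _ : Fin 7 => 7) := by
  unfold Beats
  simp only [shapeVol, sum_const, card_univ, Fintype.card_fin, nsmul_eq_mul]
  have h := rpow_343_gt
  have hM' : (M : ℝ) ≤ 706 := by exact_mod_cast hM
  norm_num at h ⊢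
  linarith

/-- **Refuted strengthening (T_A ceiling of vM ∪ E3 bounded).**  The T_A exclusion «no shape list with `≥ 2` members that is
`SieveAdmissible M` and `E3Adm M` beats `2.371` at order `M`» — certified for all `474 ≤ M ≤ 575` by `TAKnap575` and for `M ≤ 473` by
`TAKnap`/`TAKnap473` (there `E3Adm` is not even needed) — is FALSE with the range extended to `M ≤ 686`: witness `(7,7,7)⁷` at `686`.
[original] -/
theorem vmE3CensusTA_false_at_686 :
    ¬ (∀ (N M : ℕ) (a b c : Fin N → ℕ), 2 ≤ N → M ≤ 686 → SieveAdmissible M a b c → TAKnap575.E3Adm M a b c →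
        ¬ Beats (2371 / 1000) M a b c) :=
  fun h => h 7 686 _ _ _ (by norm_num) le_rfl (sieveAdmissible_777x7 686 le_rfl) (e3Adm_777x7 686 le_rfl)
    (beats_777x7 686 (by norm_num))

/-- The same witness on its whole window: for every `686 ≤ M ≤ 706`, `(7,7,7)⁷` is vM-admissible, E3-admissible and beating at `M`. [original] -/
theorem vmE3_alive_777x7 (M : ℕ) (h1 : 686 ≤ M) (h2 : M ≤ 706) :
    SieveAdmissible M (fun _ : Fin 7 => 7) (fun _ : Fin 7 => 7) (fun _ : Fin 7 => 7) ∧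
      TAKnap575.E3Adm M (fun _ : Fin 7 => 7) (fun _ : Fin 7 => 7) (fun _ : Fin 7 => 7) ∧
      Beats (2371 / 1000) M (fun _ : Fin 7 => 7) (fun _ : Fin 7 => 7) (fun _ : Fin 7 => 7) :=
  ⟨sieveAdmissible_777x7 M h1, e3Adm_777x7 M h1, beats_777x7 M h2⟩

end TAKnap575

end Summit.MatrixMultiplication.MatrixMultiplication.Theorems
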